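/-
Copyright (c) 2026 the pub-hodgecm-mathlib formalisation cell (harness21).  Prover seat hodgecm-mathlib-K2E3-p06 (g4), Track B «K2-LIT», engine E3, unit U4 «Keys»; deal (D61)
LINE LEAD of the open leaf (U4f-χ₁-ram-one), design D-I v2, plan step Z2A-3c (ii) «THE DISAGREEING TORUS ELEMENT `b₀ = d(u, 1, ū⁻¹)` AND THE LETTER `hne`» on `U(Φ₃)(L⁺_v)`;
2026-09-04.  KERNEL module: THEOREMS ONLY (no definition, no named fact, no `sorry`, no instance, no notation).
-/
import Summits.HodgeConjecture.HodgeConjecture.Theorems.K2E3BranchALettersCM               -- ★-filed Z2A-3c (i) (this seat): `symm_mem_of_mem_inf`; brings ★ Z2A-3b (`coe_eA_apply`, `map_weyl_eq_weylLongU`), the frame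
import Summits.HodgeConjecture.HodgeConjecture.Theorems.K2E3IwahoriDetection                -- ★ (K2E3-p05): `eA_mem_torusU_iff` (`eA` respects the tori)
import Literature.NumberTheory.Automorphic.CMBorelWeylTorusConjugate                        -- ★ `weylConj_mem_torusU`, `torusEntry_zero_weylConj` (`(ʷt)₀₀ = σ(t₀₀)⁻¹`)
import HarnessLib

/-!
# K2 ∕ E3 «EllipticInputs», unit U4 «Keys» — (U4f-χ₁-ram-one) step Z2A-3c (ii): THE TORUS WITNESS OF BRANCH A
# «for `u ∈ 𝒪ˣ ⊂ (L ⊗ L⁺_v)ˣ` with `χ₁(u·ū) ≠ 1`, `b₀ = d(u, 1, ū⁻¹) ∈ I ∩ T` has `θ(b₀) = χ₁(u) ≠ χ₁(ū)⁻¹ = (χδ^{1∕2})(w₀ b₀ w₀⁻¹)`»   [Keys1984 §3; Rogawski1990 §12.1]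

Cell hodgecm-mathlib (D-0151), FLOOR 0, Track B «K2-LIT», engine E3, crux item H413 = stmt-HodgeConjecture-24833 (route `HCCMUnconditional`, no route verbs); target BY NAME
the OPEN leaf `…K2E3EllipticInputs.U4Keys.sig_K2E3KeysThmTwoContractingRamifiedCharOne` (U4Keys ED. 7), design D-I v2, plan step Z2A (Branch A), CM dress.  Author K2E3-p06 (g4),
line lead (D61).  `--supports stmt-HodgeConjecture-24833 --as helper`; THEOREMS ONLY.  NOT THE PAYER.

THE POINT.  ★ Z2A-4 `K2E3BranchAContradiction.false_of_typeVector_of_integral_eq_zero` needs ONE element `b₀ ∈ I` with `w₀ b₀ w₀⁻¹ ∈ P` at which the Iwahori character `θ` and the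
conjugated inducing character disagree: `θ(b₀) ≠ τ(w₀ b₀ w₀⁻¹)·1`, `τ = (χ ∘ proj) ⊗ δ_P^{1∕2}`, `χ = (χ₁, 1)`.  BRANCH A means `χ₁ ∘ N_{L_w∕L⁺_v} ≠ 1` on units: some `u ∈ 𝒪ˣ` has
`χ₁(u ū) ≠ 1`.  THIS FILE builds `b₀ = eA⁻¹(d(u_w, 1, (σu_w)⁻¹))` (★ `exists_coe_eq_diag`) and computes both sides: `θ(b₀) = χ₁(u)` (`(b₀)₀₀ = u`, ★ `coe_eA_apply`);
`τ(w₀ b₀ w₀⁻¹)·1 = δ^{1∕2}(w₀b₀w₀⁻¹)·χ₁(torusEntry 0 (proj (w₀b₀w₀⁻¹)))` (§1, an unfolding valid for any parabolic triple) `= 1 · χ₁((σu)⁻¹)` (★ `torusEntry_zero_weylConj`; `δ^{1∕2} = 1`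
on the compact `K₀ ∋ w₀ b₀ w₀⁻¹`, ★ `rootDeltaChar_eq_one_of_mem_of_isClosed_of_isCompact`); and `χ₁(u) = χ₁((σu)⁻¹) ⟺ χ₁(u·σu) = 1`.
* §1 `twist_comp_proj_apply_one` (generic: `((σ∘proj) ⊗ δ)(x)·1 = δ(x)·σ-character(proj x)` for one-dimensional `σ = 1 ⊗ χ`).
* §2 `exists_torus_mem_inf` (the element `b₀`: in `I`, in `T`, `(b₀)₀₀ = u`), `w₀_mem_K0`.
* §3 **`exists_torusWitness`** (letters `b₀ hb₀ hb₀H hne` of ★ Z2A-4 for `θ(g) = if h : IsUnit g₀₀ then χ₁(h.unit) else 0`, `χ₂ = 1`).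
HONEST LABEL: HC_CM is proved only modulo the 7 printed citations (2 remaining named inputs: hLiu418 = stmt-HodgeConjecture-24832, h413 = stmt-HodgeConjecture-24833)
until rung 0 closes; count-neutral — this file does NOT pay the leaf; no printed citation is discharged.

## References
* [Keys1984] D. Keys, *Principal series representations of special unitary groups over local fields*, Compositio Math. 51 (1984), §3 (`W_χ` and reducibility).
* [Rogawski1990] J. Rogawski, Ann. of Math. Stud. 123 (1990), §1.10 p. 9 (the torus `d(α, β, ᾱ⁻¹)`, `w₀`); §12.1 p. 171 (`χ = (χ₁, χ₂)`).
* [BruhatTits1972] F. Bruhat, J. Tits, Publ. Math. IHÉS 41 (1972), (4.4.4).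
* [BernsteinZelevinsky1977] I. N. Bernstein, A. V. Zelevinsky, Ann. Sci. ÉNS 10 (1977), §1.8 (`δ_P^{1∕2}`, normalised induction).
-/

set_option autoImplicit false
-- the mandated namespace has the single-problem summit's repeated segment (`HodgeConjecture.HodgeConjecture`)
set_option linter.dupNamespace false

noncomputable section

open NumberField IsDedekindDomain
open scoped Matrix MatrixGroups WithZero Valued
open Literature.NumberTheory Literature.NumberTheory.Automorphic Literature.NumberTheory.Automorphic.UnitaryGroup
open Literature.NumberTheory.Rogawski1990

namespace Summit.HodgeConjecture.HodgeConjecture.Cruxes.H413.K2E3BranchATorusWitnessCM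

open Summit.HodgeConjecture.HodgeConjecture.Cruxes.H413
open Summit.HodgeConjecture.HodgeConjecture.Cruxes.H413.K2E3DepthZeroIwahoriCharacterCM
open Summit.HodgeConjecture.HodgeConjecture.Cruxes.H413.K2E3BranchALettersCM

/-! ## §1 Unfolding the inducing representation at a point -/

/-- **`((σ ∘ proj) ⊗ δ)(x) · 1 = δ(x) · χ(proj x)`** for the one-dimensional `σ = 1 ⊗ χ` of the Levi — the value of the inducing representation of a principal series at `x ∈ P`
on the vector `1 ∈ ℂ` (pure unfolding of `Representation.twist`, `Representation.trivial`). [cite: BernsteinZelevinsky1977, §1.8] -/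
theorem twist_comp_proj_apply_one {G : Type*} [Group G] (t : ParabolicTriple G) (χ : ↥t.M →* ℂˣ) (δ : ↥t.P →* ℂˣ) (x : ↥t.P) :
    (Representation.twist (((Representation.trivial ℂ ↥t.M ℂ).twist χ).comp t.proj) δ) x 1 = ((δ x : ℂˣ) : ℂ) * ((χ (t.proj x) : ℂˣ) : ℂ) := by
  show ((δ x : ℂˣ) : ℂ) • ((((Representation.trivial ℂ ↥t.M ℂ).twist χ).comp t.proj) x (1 : ℂ)) = _
  rw [MonoidHom.comp_apply]
  show ((δ x : ℂˣ) : ℂ) • (((χ (t.proj x) : ℂˣ) : ℂ) • (Representation.trivial ℂ ↥t.M ℂ (t.proj x) (1 : ℂ))) = _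
  rw [Representation.trivial_apply, smul_eq_mul, smul_eq_mul, mul_one]

/-! ## §2 The torus element `b₀ = d(u, 1, ū⁻¹)` of `U(Φ₃)(L⁺_v)` -/

variable (L : Type) [Field L] [NumberField L] [IsCMField L] (v : HeightOneSpectrum (𝓞 ↥(maximalRealSubfield L)))
  (w : PlacesOver L v) (hw : IsCMField.complexConj L • w.1 = w.1)
  (eA : Gqs L v ≃ₜ* ↥(unitaryGroupOfForm (galAdicCompletionMap (L := L) (IsCMField.complexConj L) hw) ((StdForm.antidiagonal 3).over (w.1.adicCompletion L))))
  (heA : ∀ g : Gqs L v,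
    ((eA g : ↥(unitaryGroupOfForm (galAdicCompletionMap (L := L) (IsCMField.complexConj L) hw) ((StdForm.antidiagonal 3).over (w.1.adicCompletion L)))) :
        GL (Fin 3) (w.1.adicCompletion L)) =
      ((localNonsplitEquiv (IsCMField.complexConj L) (qsForm L) (IsCMField.complexConj_ne_one L) w hw g :
        ↥(unitaryGroupOfForm (galAdicCompletionMap (L := L) (IsCMField.complexConj L) hw) (placeForm (qsForm L) w.1))) : GL (Fin 3) (w.1.adicCompletion L)))
  {ϖ : w.1.adicCompletion L} (hϖ : Valued.v ϖ = WithZero.exp (-1 : ℤ))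
  (g₁ : GL (Fin 3) (w.1.adicCompletion L)) (hg₁ : (g₁ : Matrix (Fin 3) (Fin 3) (w.1.adicCompletion L)) = Matrix.diagonal ![(1 : w.1.adicCompletion L), 1, ϖ])
  (K0 K1 I : Subgroup (Gqs L v))
  (hK0 : K0 = ((glInt 3 (w.1.adicCompletion L)).subgroupOf
    (unitaryGroupOfForm (galAdicCompletionMap (L := L) (IsCMField.complexConj L) hw) ((StdForm.antidiagonal 3).over (w.1.adicCompletion L)))).comap
      eA.toMulEquiv.toMonoidHom)
  (hK1 : K1 = (((glInt 3 (w.1.adicCompletion L)).map (MulAut.conj g₁).toMonoidHom).subgroupOf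
    (unitaryGroupOfForm (galAdicCompletionMap (L := L) (IsCMField.complexConj L) hw) ((StdForm.antidiagonal 3).over (w.1.adicCompletion L)))).comap
      eA.toMulEquiv.toMonoidHom)
  (hI : I = K0 ⊓ K1)
  (w₀ : Gqs L v) (hw₀ : Units.val (w₀.val : GL (Fin 3) (LocalRing L v)) = cmLocalForm L 3 v)

include hw heA hϖ hg₁ hK0 hK1 hI in
/-- **The element `b₀ = d(u_w, 1, (σu_w)⁻¹)` pulled back along `eA`**: for a unit `u` of `L ⊗ L⁺_v` with `|u_{w′}| = 1` there is `b₀ ∈ I` lying in the diagonal torus `T(L⁺_v)` with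
`(b₀)₀₀ = u` (★ `exists_coe_eq_diag`; `b₀ ∈ I`: integral diagonal, ★ `mem_glInt_inf_conj_glInt_of_v_lt_one`; torus ★ `eA_mem_torusU_iff`). [cite: Rogawski1990, §1.10 p. 9] -/
theorem exists_torus_mem_inf (u : (LocalRing L v)ˣ) (hu : ∀ w' : PlacesOver L v, Valued.v ((u : LocalRing L v) w') = 1) :
    ∃ b₀ : Gqs L v, b₀ ∈ I ∧
      (b₀ : ↥(unitaryGroupOfForm (conjLocal L (IsCMField.complexConj L) v) (cmLocalForm L 3 v))) ∈ (cmBorelTriple L 3 v).M ∧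
      ((b₀.val : GL (Fin 3) (LocalRing L v)) : Matrix (Fin 3) (Fin 3) (LocalRing L v)) 0 0 = (u : LocalRing L v) := by
  have hσσ : ∀ x, (galAdicCompletionMap (L := L) (IsCMField.complexConj L) hw) ((galAdicCompletionMap (L := L) (IsCMField.complexConj L) hw) x) = x :=
    galAdicCompletionMap_galAdicCompletionMap_of_smul_eq (IsCMField.complexConj L) w (IsCMField.complexConj_ne_one L) hw
  have hvσ : ∀ x, Valued.v (galAdicCompletionMap (L := L) (IsCMField.complexConj L) hw x) = Valued.v x :=
    fun x => valued_galAdicCompletionMap (L := L) (IsCMField.complexConj L) hw x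
  have hα : Valued.v ((u : LocalRing L v) w) = 1 := hu w
  have hα0 : (u : LocalRing L v) w ≠ 0 := fun h => by rw [h, map_zero] at hα; exact zero_ne_one hα
  obtain ⟨s, hsT, hs⟩ := exists_coe_eq_diag (galAdicCompletionMap (L := L) (IsCMField.complexConj L) hw)
    (rfl : (StdForm.antidiagonal 3).over (w.1.adicCompletion L) = _) hσσ hα0 (β := 1) (by rw [map_one, mul_one])
  -- `s ∈ I_w`
  have hsK0 : s ∈ (glInt 3 (w.1.adicCompletion L)).subgroupOf
      (unitaryGroupOfForm (galAdicCompletionMap (L := L) (IsCMField.complexConj L) hw) ((StdForm.antidiagonal 3).over (w.1.adicCompletion L))) := by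
    rw [mem_glInt_subgroupOf_iff _ rfl hvσ, hs]
    intro i j
    fin_cases i <;> fin_cases j <;> simp [hvσ, hα]
  have hsI := mem_glInt_inf_conj_glInt_of_v_lt_one _ rfl hvσ hϖ g₁ hg₁ hsK0 (by rw [hs]; simp)
  refine ⟨eA.symm s, symm_mem_of_mem_inf L v w hw eA g₁ K0 K1 I hK0 hK1 hI hsI, ?_, ?_⟩
  · exact (K2E3IwahoriDetection.eA_mem_torusU_iff L v w hw eA heA (eA.symm s)).1 (by rw [ContinuousMulEquiv.apply_symm_apply]; exact hsT)
  · rw [LocalRing.eq_iff_apply_eq (IsCMField.complexConj L) (IsCMField.complexConj_ne_one L) w hw, ← coe_eA_apply L v w hw eA heA (eA.symm s) 0 0,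
      ContinuousMulEquiv.apply_symm_apply, hs]
    rfl

include heA hK0 hw₀ in
/-- `w₀ ∈ K₀` (`eA w₀ = w ∈ GL₃(𝒪) ∩ U`, ★ `weylLongU_mem_glInt_subgroupOf`). [cite: Tits1979, §3.3] -/
theorem w₀_mem_K0 : w₀ ∈ K0 := by
  subst hK0
  have h : eA w₀ ∈ (glInt 3 (w.1.adicCompletion L)).subgroupOf
      (unitaryGroupOfForm (galAdicCompletionMap (L := L) (IsCMField.complexConj L) hw) ((StdForm.antidiagonal 3).over (w.1.adicCompletion L))) := by
    rw [map_weyl_eq_weylLongU L v w hw eA heA w₀ hw₀]; exact weylLongU_mem_glInt_subgroupOf _ rfl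
  exact h

/-! ## §3 The torus witness: `θ(b₀) ≠ (χδ^{1∕2})(w₀ b₀ w₀⁻¹)` -/

open Classical in
include hw heA hϖ hg₁ hK0 hK1 hI hw₀ in
set_option maxHeartbeats 1600000 in
-- the `U(Φ₃)(L⁺_v)`-valued products are read in two definitionally equal carriers (`Gqs L v` and the matrix subgroup); unification is slow
/-- **THE LETTERS `b₀ hb₀ hb₀H hne` OF ★ Z2A-4 IN BRANCH A.**  For `χ₁ : (L ⊗ L⁺_v)ˣ → ℂˣ` and a unit `u` with `|u_{w′}| = 1` and `χ₁(u · σu) ≠ 1` (Branch A: `χ₁ ∘ N ≠ 1` on units), the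
element `b₀ = d(u, 1, (σu)⁻¹)` (§2) lies in `I`, its `w₀`-conjugate lies in `P`, and the depth-zero Iwahori character `θ(b₀) = χ₁(u)` differs from the value
`((χ∘proj) ⊗ δ^{1∕2})(w₀ b₀ w₀⁻¹)·1 = χ₁((σu)⁻¹)` of the inducing representation of `i(χ₁, 1)` (§1; `δ^{1∕2} = 1` on the compact `K₀ ∋ w₀ b₀ w₀⁻¹`; ★ `torusEntry_zero_weylConj`).
[cite: Keys1984, §3] [cite: Rogawski1990, §12.1 p. 171] -/
theorem exists_torusWitness (χ₁ : (LocalRing L v)ˣ →* ℂˣ) (u : (LocalRing L v)ˣ) (hu : ∀ w' : PlacesOver L v, Valued.v ((u : LocalRing L v) w') = 1)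
    (hA : χ₁ (u * Units.map (conjLocal L (IsCMField.complexConj L) v : LocalRing L v →* LocalRing L v) u) ≠ 1) :
    ∃ (b₀ : Gqs L v) (hb₀P : ((w₀ * b₀ * w₀⁻¹ : Gqs L v) : ↥(unitaryGroupOfForm (conjLocal L (IsCMField.complexConj L) v) (cmLocalForm L 3 v))) ∈ (cmBorelTriple L 3 v).P),
      b₀ ∈ I ∧
      (if h : IsUnit (((b₀.val : GL (Fin 3) (LocalRing L v)) : Matrix (Fin 3) (Fin 3) (LocalRing L v)) 0 0) then ((χ₁ h.unit : ℂˣ) : ℂ) else 0) ≠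
        (haveI := locallyCompactSpace_cmBorelU L 3 v
         (Representation.twist
            (((Representation.trivial ℂ ↥(torusU (conjLocal L (IsCMField.complexConj L) v) (cmLocalForm L 3 v)) ℂ).twist
              (cmTorusCharPair L v χ₁ 1)).comp (cmBorelTriple L 3 v).proj) (rootDeltaChar (cmBorelTriple L 3 v).P))
          ⟨((w₀ * b₀ * w₀⁻¹ : Gqs L v) : ↥(unitaryGroupOfForm (conjLocal L (IsCMField.complexConj L) v) (cmLocalForm L 3 v))), hb₀P⟩ 1) := by
  haveI := locallyCompactSpace_cmBorelU L 3 v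
  obtain ⟨b₀, hb₀I, hb₀M, hb₀00⟩ := exists_torus_mem_inf L v w hw eA heA hϖ g₁ hg₁ K0 K1 I hK0 hK1 hI u hu
  have hJ : cmLocalForm L 3 v = (StdForm.antidiagonal 3).over (LocalRing L v) := cmLocalForm_eq_over L 3 v
  -- the torus element read in the matrix carrier, its `w₀`-conjugate
  have hconjT : ((w₀ * b₀ * w₀⁻¹ : Gqs L v) : ↥(unitaryGroupOfForm (conjLocal L (IsCMField.complexConj L) v) (cmLocalForm L 3 v))) ∈ torusU (conjLocal L (IsCMField.complexConj L) v) (cmLocalForm L 3 v) :=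
    weylConj_mem_torusU (conjLocal L (IsCMField.complexConj L) v) hJ w₀ hw₀
      (⟨b₀, hb₀M⟩ : ↥(torusU (conjLocal L (IsCMField.complexConj L) v) (cmLocalForm L 3 v)))
  have hb₀P : ((w₀ * b₀ * w₀⁻¹ : Gqs L v) : ↥(unitaryGroupOfForm (conjLocal L (IsCMField.complexConj L) v) (cmLocalForm L 3 v))) ∈ (cmBorelTriple L 3 v).P :=
    torusU_le_borelU (conjLocal L (IsCMField.complexConj L) v) (cmLocalForm L 3 v) hconjT
  refine ⟨b₀, hb₀P, hb₀I, ?_⟩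
  -- left-hand side: `θ(b₀) = χ₁(u)`
  have hU : IsUnit (((b₀.val : GL (Fin 3) (LocalRing L v)) : Matrix (Fin 3) (Fin 3) (LocalRing L v)) 0 0) := by rw [hb₀00]; exact Units.isUnit u
  have hunit : hU.unit = u := Units.ext (by rw [IsUnit.unit_spec, hb₀00])
  rw [dif_pos hU, hunit]
  -- right-hand side: `δ^{1/2}(w₀ b₀ w₀⁻¹) · χ₁(torusEntry 0 (proj (w₀ b₀ w₀⁻¹)))`
  rw [twist_comp_proj_apply_one (cmBorelTriple L 3 v) (cmTorusCharPair L v χ₁ 1) (rootDeltaChar (cmBorelTriple L 3 v).P) ⟨_, hb₀P⟩]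
  -- `δ^{1/2} = 1` on the compact `K₀`
  have hlev := F0P3cStCharTSStLevelsTransport.isOpen_isCompact_levels L v w hw eA g₁ K0 K1 I hK0 hK1 hI
  have hw0K : w₀ ∈ K0 := w₀_mem_K0 L v w hw eA heA K0 hK0 w₀ hw₀
  have hb0K : b₀ ∈ K0 := by rw [hI] at hb₀I; exact (Subgroup.mem_inf.1 hb₀I).1
  have hxK : w₀ * b₀ * w₀⁻¹ ∈ K0 := Subgroup.mul_mem _ (Subgroup.mul_mem _ hw0K hb0K) (Subgroup.inv_mem _ hw0K)
  have hδ : rootDeltaChar (cmBorelTriple L 3 v).P ⟨_, hb₀P⟩ = 1 :=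
    rootDeltaChar_eq_one_of_mem_of_isClosed_of_isCompact (cmBorelTriple L 3 v).P
      (isClosed_borelU (conjLocal L (IsCMField.complexConj L) v) (cmLocalForm L 3 v)) (K := K0) hlev.1.2 hxK
  rw [hδ, Units.val_one, one_mul]
  -- the `χ`-value at the conjugated torus element: `χ₁((σu)⁻¹)`
  have hproj : (cmBorelTriple L 3 v).proj ⟨_, hb₀P⟩ = ⟨((w₀ * b₀ * w₀⁻¹ : Gqs L v) : ↥(unitaryGroupOfForm (conjLocal L (IsCMField.complexConj L) v) (cmLocalForm L 3 v))), hconjT⟩ :=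
    proj_weylConj (conjLocal L (IsCMField.complexConj L) v) hJ w₀ hw₀
      (⟨b₀, hb₀M⟩ : ↥(torusU (conjLocal L (IsCMField.complexConj L) v) (cmLocalForm L 3 v)))
  have hentry : torusEntry (conjLocal L (IsCMField.complexConj L) v) (cmLocalForm L 3 v) 0 ⟨((w₀ * b₀ * w₀⁻¹ : Gqs L v) : ↥(unitaryGroupOfForm (conjLocal L (IsCMField.complexConj L) v) (cmLocalForm L 3 v))), hconjT⟩ =
      (Units.map (conjLocal L (IsCMField.complexConj L) v : LocalRing L v →* LocalRing L v) u)⁻¹ := by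
    have h := torusEntry_zero_weylConj (conjLocal L (IsCMField.complexConj L) v) hJ w₀ hw₀
      (⟨b₀, hb₀M⟩ : ↥(torusU (conjLocal L (IsCMField.complexConj L) v) (cmLocalForm L 3 v)))
    have hT0 : torusEntry (conjLocal L (IsCMField.complexConj L) v) (cmLocalForm L 3 v) 0
        (⟨b₀, hb₀M⟩ : ↥(torusU (conjLocal L (IsCMField.complexConj L) v) (cmLocalForm L 3 v))) = u :=
      Units.ext (by rw [coe_torusEntry]; exact hb₀00)
    rw [hT0] at h
    exact h
  rw [show cmTorusCharPair L v χ₁ 1 = torusCharPair (conjLocal L (IsCMField.complexConj L) v) (cmLocalForm L 3 v) hJ 0 χ₁ 1 from rfl,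
    torusCharPair_apply, MonoidHom.one_apply, mul_one, hproj, hentry]
  -- `χ₁(u) ≠ χ₁((σu)⁻¹)` from `χ₁(u · σu) ≠ 1`
  intro heq
  apply hA
  have h1 : χ₁ u = χ₁ (Units.map (conjLocal L (IsCMField.complexConj L) v : LocalRing L v →* LocalRing L v) u)⁻¹ := Units.ext heq
  rw [map_mul, h1, map_inv, inv_mul_cancel]

end Summit.HodgeConjecture.HodgeConjecture.Cruxes.H413.K2E3BranchATorusWitnessCM

end
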